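import Literature.MathematicalPhysics.QuantumChemistry.ThreeIndexConditionsT2Prime
import HarnessLib

/-!
# Restricted (orbital-subset / principal-submatrix) three-index conditions `T1[A]`, `T2[A]`, `T2′[A]`

Topic `Literature/MathematicalPhysics/QuantumChemistry`; a three-corollary annex to
`ThreeIndexConditionsTwoRDM.lean` / `ThreeIndexConditionsT2Prime.lean` recording the soundness of the
RESTRICTED three-index positivity conditions used by block-selected ("restricted") `T1`/`T2′` multipliers
in variational-2-RDM lower bounds: for ANY re-indexing map `e` of the index set (in particular the inclusion
of the sub-family of operator triples / singles whose orbital indices lie in a chosen orbital set `A`), the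
re-indexed principal submatrix of the `T1`, `T2` (anticommutator form) and `T2′` matrices of a Fock-space
vector is positive semidefinite. This is `Matrix.PosSemidef.submatrix` applied to the tree's
`t1Transpose_posSemidef`, `t2Anticomm_posSemidef`, `t2Prime_posSemidef`; equivalently, the operator
identity behind each condition holds word for word for every sub-family (it never uses completeness of
the index set). Consequence (the certificate-level statement, words only): a dual multiplier of the full
`T2′` block supported on an `A`-indexed principal sub-block is a valid multiplier (zero-padding a PSD matrix
keeps it PSD), so "any dual-feasible restriction is still a valid certificate" — Nakata et al. (2008) §II.C
hierarchy extends to `E_DQG ≤ E_DQG+T[A] ≤ E_DQG+T[A'] (A ⊆ A') ≤ E_DQGT1T2′`. 0 sorry, no definitions,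
no named facts. [cite: NakataEtAl2008, §II.A–§II.C]
-/

noncomputable section

namespace Literature.MathematicalPhysics.QuantumChemistry

open Matrix Literature.MathematicalPhysics.QuantumLattice
open scoped ComplexOrder

variable {ι : Type*} [LinearOrder ι] [Fintype ι] {κ : Type*}

/-- **Restricted `T1` condition.** For every Fock-space vector `ψ` and every re-indexing `e : κ → ι × ι × ι`
(e.g. the inclusion of the triples with all indices in an orbital subset `A`), the principal submatrix
`(³D + ³Qᵀ).submatrix e e` of the anticommutator-form `T1` matrix is positive semidefinite.
Nakata et al. (2008) §II.A with `Matrix.PosSemidef.submatrix`. [cite: NakataEtAl2008, §II.A] -/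
theorem t1Transpose_submatrix_posSemidef (ψ : Fock ι) (e : κ → ι × ι × ι) :
    ((metricMatrix threeCreate ψ + (metricMatrix threeAnnihilate ψ)ᵀ).submatrix e e).PosSemidef :=
  (t1Transpose_posSemidef ψ).submatrix e

/-- **Restricted `T2` condition (anticommutator form).** For every Fock-space vector `ψ` and every
re-indexing `e : κ → ι × ι × ι`, the principal submatrix of the `T2` matrix
`(⟨ψ| C_I C_J† + C_J† C_I |ψ⟩)`, `C_I = a†_i a†_j a_k`, is positive semidefinite.
Nakata et al. (2008) §II.A with `Matrix.PosSemidef.submatrix`. [cite: NakataEtAl2008, §II.A] -/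
theorem t2Anticomm_submatrix_posSemidef (ψ : Fock ι) (e : κ → ι × ι × ι) :
    ((metricMatrix twoCreateAnnihilate ψ +
      (metricMatrix (fun t : ι × ι × ι => (twoCreateAnnihilate t)ᴴ) ψ)ᵀ).submatrix e e).PosSemidef :=
  (t2Anticomm_posSemidef ψ).submatrix e

/-- **Restricted `T2′` condition.** For every Fock-space vector `ψ` and every re-indexing
`e : κ → (ι × ι × ι) ⊕ ι` of the `T2′` index set (triples of `a†a†a` together with the singles of the
one-body border), the principal submatrix `T2′.submatrix e e` of the Braams–Percus–Zhao `T2′` matrix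
`( T2 X ; X† γ )` is positive semidefinite — the soundness of orbital-subset-restricted ("block-selected")
`T2′` conditions / multipliers. Nakata et al. (2008) §II.B with `Matrix.PosSemidef.submatrix`.
[cite: NakataEtAl2008, §II.B] -/
theorem t2Prime_submatrix_posSemidef (ψ : Fock ι) (e : κ → (ι × ι × ι) ⊕ ι) :
    ((metricMatrix (Sum.elim twoCreateAnnihilate creation) ψ +
      (metricMatrix (Sum.elim (fun t : ι × ι × ι => (twoCreateAnnihilate t)ᴴ)
        (0 : ι → Matrix (Finset ι) (Finset ι) ℂ)) ψ)ᵀ).submatrix e e).PosSemidef :=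
  (t2Prime_posSemidef ψ).submatrix e

end Literature.MathematicalPhysics.QuantumChemistry
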